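import Mathlib
import Summits.Ventures.HodgeRepro.Tier4.Line4.PlaceIdem
import Summits.Ventures.HodgeRepro.Tier4.Line4.CentralScalars
import Summits.Ventures.HodgeRepro.Tier4.Line4.TorusProduct

/-!
# Tier4/Line4/PlaceIdemSet — the idempotent `1_S` of a SET of finite places, the `S`-part / away-from-`S` part of a
finite-adele matrix, and the generic `e`-part `GA.idemPart` of an adelic unitary element (C-L4-PSPLIT, Part A.1a′)

Blind re-derivation cell `pub-hodge-repro`, Tier 4 «prove the step» (README §9–§10), seat t4-L2-p1 (gen 3; plan-4 g5's cut
C-L4-PSPLIT S15510, statement S15526).  Tree path `lean/Summits/Ventures/HodgeRepro/Tier4/Line4/PlaceIdemSet.lean`.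
Definitions lane.  Imports `Line4/PlaceIdem` (the idempotent calculus `idemMix`, the component rfl-lemmas),
`Line4/CentralScalars` (`mem_finitePart_iff_infM`), `Line4/TorusProduct`.  Mathlib-level; no literature.

WHY A SET.  The level sequence of record is `p^n` for a RATIONAL prime `p`, which shrinks the level at EVERY place `v ∣ p` of
`k` (finitely many): the `p`-split of the finite torus is the split along the set `S = {v : v ∣ p}` of places above `p`, not
along one place.  So the idempotent is `1_S` (`setIdem k S`: component `1` on `S`, `0` elsewhere; `setIdem_singleton` gives
`1_{{v}} = 1_v`), and `atFinMS S F := 1_S • F + (1 − 1_S) • 1` / `awayFinMS S F := (1 − 1_S) • F + 1_S • 1` are the `S`-part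
and the away part of a finite-adele matrix, with the same laws as the one-place versions (`idemMix_*` of PlaceIdem applied to
`e := 1_S`, `e := 1 − 1_S`) and the component laws `atFinMS_apply_apply` / `awayFinMS_apply_apply`.
THE GENERIC PART.  For an idempotent `e ∈ 𝔸_{k,f}`, `GA.idemPart W e he g ∈ G(𝔸)` has matrix
`mixM 1 (idemMix e (finM (mat g)))` (archimedean part the identity, finite part `e • g_f + (1 − e) • 1`): unitary because the
`Ω` / `B` identities are `e`-linear (`idemMix_mul_comm_of_comm`, `idemMix_mul_mul_transpose_of`), multiplicative, inverse-
compatible, continuous (entrywise `x ↦ e x + (1 − e) c` in the topological ring), in `G(𝔸_f)`, in every commutant `g` is in.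
The parts `GA.ofPlacesPart W S := idemPart (1_S)` / `GA.offPlacesPart W S := idemPart (1 − 1_S)` and their laws are
`Line4/PlacePart`.

Nothing here says anything about the status of the Hodge conjecture for CM abelian varieties, which is NOT proved
(HC_CM is NOT proved by anyone in this repository).
-/

set_option autoImplicit false
noncomputable section
namespace Summit.Ventures.HodgeRepro.Tier4.Line4
open Summit.Ventures.HodgeRepro.Tier4 Summit.Ventures.HodgeRepro.Tier4.Common
  Summit.Ventures.HodgeRepro.Tier4.Line1 NumberField IsDedekindDomain Matrix
open scoped NumberField Classical

section IdemSet
variable (k : Type) [Field k] [NumberField k]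

/-- **The idempotent `1_S`** of a set `S` of finite places: component `1` at the places of `S`, `0` elsewhere. -/
def setIdem (S : Set (HeightOneSpectrum (𝓞 k))) : FiniteAdeleRing (𝓞 k) k :=
  RestrictedProduct.mk (fun w : HeightOneSpectrum (𝓞 k) => if w ∈ S then (1 : w.adicCompletion k) else 0)
    (Filter.Eventually.of_forall fun w => by
      split_ifs
      · exact one_mem _
      · exact zero_mem _)

variable {k}
variable (S : Set (HeightOneSpectrum (𝓞 k)))

/-- The components of `1_S`. -/
theorem setIdem_apply (w : HeightOneSpectrum (𝓞 k)) :
    setIdem k S w = if w ∈ S then (1 : w.adicCompletion k) else 0 := rfl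

/-- `1_S` is idempotent. -/
theorem setIdem_mul_self : setIdem k S * setIdem k S = setIdem k S := by
  refine fa_ext fun w => ?_
  rw [fa_mul_apply, setIdem_apply]
  split_ifs <;> simp

/-- `1 − 1_S` is idempotent. -/
theorem one_sub_setIdem_mul_self : (1 - setIdem k S) * (1 - setIdem k S) = 1 - setIdem k S := by
  rw [sub_mul, one_mul, mul_sub, mul_one, setIdem_mul_self, sub_self, sub_zero]

/-- The components of `1 − 1_S`. -/
theorem one_sub_setIdem_apply (w : HeightOneSpectrum (𝓞 k)) :
    (1 - setIdem k S) w = if w ∈ S then (0 : w.adicCompletion k) else 1 := by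
  rw [fa_sub_apply, fa_one_apply, setIdem_apply]
  split_ifs <;> simp

/-- `1_{{v}} = 1_v`. -/
theorem setIdem_singleton (v : HeightOneSpectrum (𝓞 k)) : setIdem k {v} = placeIdem k v := by
  refine fa_ext fun w => ?_
  rw [setIdem_apply, placeIdem_apply, Set.mem_singleton_iff]

/-- **The `S`-part of a finite-adele matrix**: `F` at the places of `S`, the identity elsewhere. -/
def atFinMS (F : M4f k) : M4f k := idemMix k (setIdem k S) F

/-- **The away-from-`S` part of a finite-adele matrix**: the identity at the places of `S`, `F` elsewhere. -/
def awayFinMS (F : M4f k) : M4f k := idemMix k (1 - setIdem k S) F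

/-- The `S`-part of `1` is `1`. -/
theorem atFinMS_one : atFinMS S (1 : M4f k) = 1 := idemMix_one _
/-- The away part of `1` is `1`. -/
theorem awayFinMS_one : awayFinMS S (1 : M4f k) = 1 := idemMix_one _
/-- The `S`-part is multiplicative. -/
theorem atFinMS_mul (F G : M4f k) : atFinMS S (F * G) = atFinMS S F * atFinMS S G :=
  idemMix_mul (setIdem_mul_self S) F G
/-- The away part is multiplicative. -/
theorem awayFinMS_mul (F G : M4f k) : awayFinMS S (F * G) = awayFinMS S F * awayFinMS S G :=
  idemMix_mul (one_sub_setIdem_mul_self S) F G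
/-- The `S`-part commutes with transpose. -/
theorem atFinMS_transpose (F : M4f k) : (atFinMS S F)ᵀ = atFinMS S Fᵀ := idemMix_transpose _ F
/-- The away part commutes with transpose. -/
theorem awayFinMS_transpose (F : M4f k) : (awayFinMS S F)ᵀ = awayFinMS S Fᵀ := idemMix_transpose _ F

/-- `F = F_S · F^{(S)}`. -/
theorem atFinMS_mul_awayFinMS (F : M4f k) : atFinMS S F * awayFinMS S F = F :=
  idemMix_mul_idemMix_one_sub (setIdem_mul_self S) F

/-- The components of the `S`-part: `F` on `S`, the identity elsewhere. -/
theorem atFinMS_apply_apply (F : M4f k) (i j : Fin 4) (w : HeightOneSpectrum (𝓞 k)) :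
    atFinMS S F i j w = if w ∈ S then F i j w else (1 : M4f k) i j w := by
  show (setIdem k S * F i j + (1 - setIdem k S) * (1 : M4f k) i j) w = _
  rw [fa_add_apply, fa_mul_apply, fa_mul_apply, setIdem_apply, one_sub_setIdem_apply]
  split_ifs <;> simp

/-- The components of the away part: the identity on `S`, `F` elsewhere. -/
theorem awayFinMS_apply_apply (F : M4f k) (i j : Fin 4) (w : HeightOneSpectrum (𝓞 k)) :
    awayFinMS S F i j w = if w ∈ S then (1 : M4f k) i j w else F i j w := by
  show ((1 - setIdem k S) * F i j + (1 - (1 - setIdem k S)) * (1 : M4f k) i j) w = _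
  rw [sub_sub_cancel, fa_add_apply, fa_mul_apply, fa_mul_apply, setIdem_apply, one_sub_setIdem_apply]
  split_ifs <;> simp

/-- A matrix that is the identity off `S` is its own `S`-part. -/
theorem atFinMS_eq_self_of_forall_notMem {F : M4f k} (h : ∀ w, w ∉ S → ∀ i j, F i j w = (1 : M4f k) i j w) :
    atFinMS S F = F := by
  refine Matrix.ext fun i j => fa_ext fun w => ?_
  rw [atFinMS_apply_apply]
  split_ifs with hw
  · rfl
  · exact (h w hw i j).symm

/-- A matrix that is the identity on `S` has `S`-part `1`. -/
theorem atFinMS_eq_one_of_forall_mem {F : M4f k} (h : ∀ w, w ∈ S → ∀ i j, F i j w = (1 : M4f k) i j w) :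
    atFinMS S F = 1 := by
  refine Matrix.ext fun i j => fa_ext fun w => ?_
  rw [atFinMS_apply_apply]
  split_ifs with hw
  · exact h w hw i j
  · rfl

/-- A matrix that is the identity off `S` has away part `1`. -/
theorem awayFinMS_eq_one_of_forall_notMem {F : M4f k} (h : ∀ w, w ∉ S → ∀ i j, F i j w = (1 : M4f k) i j w) :
    awayFinMS S F = 1 := by
  refine Matrix.ext fun i j => fa_ext fun w => ?_
  rw [awayFinMS_apply_apply]
  split_ifs with hw
  · rfl
  · exact h w hw i j

/-- A matrix that is the identity on `S` is its own away part. -/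
theorem awayFinMS_eq_self_of_forall_mem {F : M4f k} (h : ∀ w, w ∈ S → ∀ i j, F i j w = (1 : M4f k) i j w) :
    awayFinMS S F = F := by
  refine Matrix.ext fun i j => fa_ext fun w => ?_
  rw [awayFinMS_apply_apply]
  split_ifs with hw
  · exact (h w hw i j).symm
  · rfl

end IdemSet

section Parts
variable {k : Type} [Field k] [NumberField k] (W : PlaneData k)

/-- The `w`-component of the identity finite-adele matrix is the identity. -/
theorem one_M4f_apply_apply (i j : Fin 4) (w : HeightOneSpectrum (𝓞 k)) :
    (1 : M4f k) i j w = (1 : Matrix (Fin 4) (Fin 4) (w.adicCompletion k)) i j := by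
  rw [Matrix.one_apply, Matrix.one_apply]
  split_ifs
  · exact fa_one_apply w
  · exact fa_zero_apply w

/-- The `w`-component of an entry of `finM M` is the `w`-component of the entry. -/
theorem finM_apply_apply (M : M4 k) (i j : Fin 4) (w : HeightOneSpectrum (𝓞 k)) :
    finM k M i j w = adComponentFin k w (M i j) := rfl

/-- **The `e`-part of `g ∈ G(𝔸)`** for an idempotent `e ∈ 𝔸_{k,f}`: archimedean part the identity, finite part
`e • g_f + (1 − e) • 1`.  Unitary because the `Ω` / `B` identities are `e`-linear. -/
def GA.idemPart (e : FiniteAdeleRing (𝓞 k) k) (he : e * e = e) (g : GA W) : GA W :=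
  ⟨⟨mixM k 1 (idemMix k e (finM k (GA.mat W g))), mixM k 1 (idemMix k e (finM k (GA.mat W g⁻¹))),
    by
      apply M4_ext
      · simp only [infM_mul, infM_mixM, infM_one, Matrix.one_mul]
      · rw [finM_mul, finM_mixM, finM_mixM, ← idemMix_mul he, ← finM_mul, GA.mat_mul_inv, finM_one, idemMix_one],
    by
      apply M4_ext
      · simp only [infM_mul, infM_mixM, infM_one, Matrix.one_mul]
      · rw [finM_mul, finM_mixM, finM_mixM, ← idemMix_mul he, ← finM_mul, GA.mat_inv_mul, finM_one, idemMix_one]⟩,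
    by
      have hΩ := ((mem_unitaryGroup W _).1 g.2).1
      have hB := ((mem_unitaryGroup W _).1 g.2).2
      have hΩf : finM k (GA.mat W g) * finM k (adMat k W.Ω) = finM k (adMat k W.Ω) * finM k (GA.mat W g) := by
        have := congrArg (finM k) hΩ
        rwa [finM_mul, finM_mul] at this
      have hBf : finM k (GA.mat W g) * finM k (adMat k W.B) * (finM k (GA.mat W g))ᵀ = finM k (adMat k W.B) := by
        have := congrArg (finM k) hB
        rwa [finM_mul, finM_mul, finM_transpose] at this
      refine ⟨?_, ?_⟩
      · change mixM k 1 (idemMix k e (finM k (GA.mat W g))) * adMat k W.Ω =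
          adMat k W.Ω * mixM k 1 (idemMix k e (finM k (GA.mat W g)))
        apply M4_ext
        · simp only [infM_mul, infM_mixM, Matrix.one_mul, Matrix.mul_one]
        · rw [finM_mul, finM_mul, finM_mixM]
          exact idemMix_mul_comm_of_comm e hΩf
      · change mixM k 1 (idemMix k e (finM k (GA.mat W g))) * adMat k W.B *
          (mixM k 1 (idemMix k e (finM k (GA.mat W g))))ᵀ = adMat k W.B
        apply M4_ext
        · simp only [infM_mul, infM_transpose, infM_mixM, Matrix.one_mul, Matrix.transpose_one, Matrix.mul_one]
        · rw [finM_mul, finM_mul, finM_transpose, finM_mixM]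
          exact idemMix_mul_mul_transpose_of he hBf⟩

variable {e : FiniteAdeleRing (𝓞 k) k} (he : e * e = e)

/-- The matrix of the `e`-part. -/
theorem GA.mat_idemPart (g : GA W) :
    GA.mat W (GA.idemPart W e he g) = mixM k 1 (idemMix k e (finM k (GA.mat W g))) := rfl

/-- The `e`-part of `1` is `1`. -/
theorem idemPart_one : GA.idemPart W e he 1 = 1 := by
  apply Subtype.ext
  apply Units.ext
  change GA.mat W (GA.idemPart W e he 1) = (1 : M4 k)
  have h1 : GA.mat W (1 : GA W) = (1 : M4 k) := rfl
  rw [GA.mat_idemPart, h1]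
  apply M4_ext
  · rw [infM_mixM, infM_one]
  · rw [finM_mixM, finM_one, idemMix_one]

/-- The `e`-part is multiplicative. -/
theorem idemPart_mul (g h : GA W) : GA.idemPart W e he (g * h) = GA.idemPart W e he g * GA.idemPart W e he h := by
  apply Subtype.ext
  apply Units.ext
  change GA.mat W (GA.idemPart W e he (g * h)) = GA.mat W (GA.idemPart W e he g) * GA.mat W (GA.idemPart W e he h)
  rw [GA.mat_idemPart, GA.mat_idemPart, GA.mat_idemPart, GA.mat_mul]
  apply M4_ext
  · simp only [infM_mul, infM_mixM, Matrix.one_mul]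
  · simp only [finM_mul, finM_mixM, idemMix_mul he]

/-- The `e`-part of an inverse is the inverse of the `e`-part. -/
theorem idemPart_inv (g : GA W) : GA.idemPart W e he g⁻¹ = (GA.idemPart W e he g)⁻¹ := by
  apply eq_inv_of_mul_eq_one_left
  rw [← idemPart_mul, inv_mul_cancel, idemPart_one]

/-- The `e`-part lies in `G(𝔸_f)`. -/
theorem idemPart_mem_finitePart (g : GA W) : GA.idemPart W e he g ∈ finitePart W := by
  rw [mem_finitePart_iff_infM, GA.mat_idemPart, infM_mixM]

/-- The `e`-part of an element of a commutant lies in the commutant. -/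
theorem idemPart_mem_commutant (A : Matrix (Fin 4) (Fin 4) k) {g : GA W} (hg : g ∈ commutant W A) :
    GA.idemPart W e he g ∈ commutant W A := by
  have hg' : GA.mat W g * adMat k A = adMat k A * GA.mat W g := hg
  change GA.mat W (GA.idemPart W e he g) * adMat k A = adMat k A * GA.mat W (GA.idemPart W e he g)
  rw [GA.mat_idemPart]
  apply M4_ext
  · simp only [infM_mul, infM_mixM, Matrix.one_mul, Matrix.mul_one]
  · have h2 := congrArg (finM k) hg'
    rw [finM_mul, finM_mul] at h2
    simp only [finM_mul, finM_mixM]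
    exact idemMix_mul_comm_of_comm e h2

/-- The `e`-part of an element of `T` lies in `T`. -/
theorem idemPart_mem_torusT {g : GA W} (hg : g ∈ torusT W) : GA.idemPart W e he g ∈ torusT W :=
  Subgroup.mem_inf.2 ⟨idemPart_mem_commutant W he _ (Subgroup.mem_inf.1 hg).1,
    idemPart_mem_commutant W he _ (Subgroup.mem_inf.1 hg).2⟩

/-- The `e`-part of an element of `T′` lies in `T′`. -/
theorem idemPart_mem_torusT' {g : GA W} (hg : g ∈ torusT' W) : GA.idemPart W e he g ∈ torusT' W :=
  Subgroup.mem_inf.2 ⟨idemPart_mem_commutant W he _ (Subgroup.mem_inf.1 hg).1,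
    idemPart_mem_commutant W he _ (Subgroup.mem_inf.1 hg).2⟩

/-- The `e`-part is continuous (entrywise `x ↦ e x + (1 − e) c` in the topological ring `𝔸_{k,f}`). -/
theorem continuous_idemPart : Continuous (GA.idemPart W e he) := by
  have hmat : Continuous fun g : GA W => GA.mat W g := Units.continuous_val.comp continuous_subtype_val
  have hmatinv : Continuous fun g : GA W => GA.mat W g⁻¹ := by
    have h1 : Continuous fun g : GA W => ((g : GL4 k)⁻¹ : GL4 k) := continuous_inv.comp continuous_subtype_val
    exact Units.continuous_val.comp h1
  have hmix : ∀ F : GA W → M4 k, Continuous F → Continuous fun g => mixM k 1 (idemMix k e (finM k (F g))) := by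
    intro F hF
    refine continuous_matrix fun i j => ?_
    show Continuous fun g => ((1 : Matrix (Fin 4) (Fin 4) (NumberField.InfiniteAdeleRing k)) i j,
      e * finPart k (F g i j) + (1 - e) * (1 : M4f k) i j)
    exact continuous_const.prodMk
      ((continuous_const.mul (continuous_finPart.comp (hF.matrix_elem i j))).add continuous_const)
  refine Continuous.subtype_mk ?_ _
  refine Units.continuous_iff.2 ⟨?_, ?_⟩
  · exact hmix (fun g => GA.mat W g) hmat
  · exact hmix (fun g => GA.mat W g⁻¹) hmatinv

/-- The components of the `e`-part's finite matrix. -/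
theorem finM_mat_idemPart (g : GA W) : finM k (GA.mat W (GA.idemPart W e he g)) = idemMix k e (finM k (GA.mat W g)) := by
  rw [GA.mat_idemPart, finM_mixM]

end Parts

end Summit.Ventures.HodgeRepro.Tier4.Line4

end
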